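import Summits.QuantumFields.YangMills.Theorems.AllWindowsColdBoxBoxHighLineTiltNormTransferGauss
import Summits.QuantumFields.YangMills.Theorems.AllWindowsColdBoxBoxHighLineEdgeChartParity

/-!
# T-S5.13 parity on the small-field Gaussian `μ_D` — odd observables have zero tilted expectation at `t = 0` (ASSEMBLY-S5 §5/§6 (e4): the parity split of `f′(0)`)

Planner ym-idea-2 g18's `ASSEMBLY-S5.md` §5 («D symmetric under a ↦ −a», «V₃ odd; W₄, U_Φ, U_Haar even») and §6 (e4) («`f′(0) = E_D[c̃₀c̃_TŨ]` splits by parity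
into even × even × Ũ_even and odd × odd pieces»).  In the tilt letters of ✓`…Step2Tilt` over `μ_D := (volume.restrict (smallField H s)).withDensity (ofReal ∘ gaussWeight β H)`
(w5 g22's ✓`Tilt.tiltExp_muD_eq_ratio`), using the `gaussAvg` parity rules of ✓`…EdgeChartParity`:

* `tiltExp_muD_zero_eq` — `E_0[G] = gaussAvg(sfInd·G)/gaussAvg(sfInd)` (the `t = 0` case);
* ★`tiltExp_muD_zero_eq_zero_of_odd` — odd `G` ⇒ `E_0[G] = 0` on `μ_D` (no integrability needed); `tiltExp_muD_zero_mul_eq_zero_of_even_odd`, `…_of_odd_even`;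
* `tiltCov_muD_zero_eq_zero_of_even_odd` — `Cov_0(F,G) = 0` for `F` even, `G` odd;
* the four vanishing patterns of the (e4) split, with centrings: `tiltExp_muD_zero_even_even_odd`, `…_odd_odd_odd`, `…_even_odd_even`, `…_odd_even_even`;
  `tiltExp_muD_zero_cubicVertex` (`E_0[V₃] = 0` on `μ_D`).

Tree (✓TiltNormTransferGauss, ✓EdgeChartParity) + Mathlib; no definitions.  HONEST LABEL: bookkeeping for the T-S5.13 assembly of the XL stub S5 of a critic-PASSed DRAFT line;
T-S5.13/S5, U5, ⟨24004⟩ ⟨24335⟩ ⟨24336⟩ remain OPEN; route AllWindowsColdBox is DRAFT; no rung is proved; the Yang–Mills mass gap is NOT proved by this file.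
Seat ym-line-sfw-p2 g77 (LEAD, cell ym-idea-1; T-S5.13 assembler of record).
-/

set_option autoImplicit false

noncomputable section

open MeasureTheory Set
open scoped ENNReal

namespace Summit.QuantumFields.YangMills.Theorems.AllWindowsColdBoxBoxHighLine

namespace Tilt

variable (H : ℕ)

/-- `E_0[G]` over `μ_D` in `gaussAvg` letters: `gaussAvg(sfInd·G)/gaussAvg(sfInd)`. -/
theorem tiltExp_muD_zero_eq {β : ℝ} (hβ : 0 < β) (s : ℝ) (U G : (LandauFree H → E3) → ℝ) :
    tiltExp ((volume.restrict (smallField H s)).withDensity fun a => ENNReal.ofReal (gaussWeight β H a)) U 0 G =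
      gaussAvg β H (fun a => sfInd H s a * G a) / gaussAvg β H (sfInd H s) := by
  rw [tiltExp_muD_eq_ratio H hβ s U 0 G]
  simp only [zero_mul, Real.exp_zero, mul_one]

/-- ★ **Parity on `μ_D`**: an odd observable has `E_0[G] = 0` (the small-field set and the Gaussian weight are even). -/
theorem tiltExp_muD_zero_eq_zero_of_odd {β : ℝ} (hβ : 0 < β) (s : ℝ) (U : (LandauFree H → E3) → ℝ) {G : (LandauFree H → E3) → ℝ}
    (hG : ∀ a, G (-a) = -G a) :
    tiltExp ((volume.restrict (smallField H s)).withDensity fun a => ENNReal.ofReal (gaussWeight β H a)) U 0 G = 0 := by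
  rw [tiltExp_muD_zero_eq H hβ, EdgeChartGaussian.gaussAvg_sfInd_mul_eq_zero_of_odd β H s hG, zero_div]

/-- Even × odd ⇒ `E_0 = 0` on `μ_D`. -/
theorem tiltExp_muD_zero_mul_eq_zero_of_even_odd {β : ℝ} (hβ : 0 < β) (s : ℝ) (U : (LandauFree H → E3) → ℝ) {F G : (LandauFree H → E3) → ℝ}
    (hF : ∀ a, F (-a) = F a) (hG : ∀ a, G (-a) = -G a) :
    tiltExp ((volume.restrict (smallField H s)).withDensity fun a => ENNReal.ofReal (gaussWeight β H a)) U 0 (fun a => F a * G a) = 0 :=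
  tiltExp_muD_zero_eq_zero_of_odd H hβ s U fun a => by rw [hF, hG, mul_neg]

/-- Odd × even ⇒ `E_0 = 0` on `μ_D`. -/
theorem tiltExp_muD_zero_mul_eq_zero_of_odd_even {β : ℝ} (hβ : 0 < β) (s : ℝ) (U : (LandauFree H → E3) → ℝ) {F G : (LandauFree H → E3) → ℝ}
    (hF : ∀ a, F (-a) = -F a) (hG : ∀ a, G (-a) = G a) :
    tiltExp ((volume.restrict (smallField H s)).withDensity fun a => ENNReal.ofReal (gaussWeight β H a)) U 0 (fun a => F a * G a) = 0 :=
  tiltExp_muD_zero_eq_zero_of_odd H hβ s U fun a => by rw [hF, hG, neg_mul]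

/-- `Cov_0(F,G) = 0` on `μ_D` for `F` even and `G` odd. -/
theorem tiltCov_muD_zero_eq_zero_of_even_odd {β : ℝ} (hβ : 0 < β) (s : ℝ) (U : (LandauFree H → E3) → ℝ) {F G : (LandauFree H → E3) → ℝ}
    (hF : ∀ a, F (-a) = F a) (hG : ∀ a, G (-a) = -G a) :
    tiltCov ((volume.restrict (smallField H s)).withDensity fun a => ENNReal.ofReal (gaussWeight β H a)) U 0 F G = 0 := by
  unfold tiltCov
  rw [tiltExp_muD_zero_mul_eq_zero_of_even_odd H hβ s U hF hG, tiltExp_muD_zero_eq_zero_of_odd H hβ s U hG, mul_zero, sub_zero]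

/-- `Cov_0(F,G) = 0` on `μ_D` for `F` odd and `G` even. -/
theorem tiltCov_muD_zero_eq_zero_of_odd_even {β : ℝ} (hβ : 0 < β) (s : ℝ) (U : (LandauFree H → E3) → ℝ) {F G : (LandauFree H → E3) → ℝ}
    (hF : ∀ a, F (-a) = -F a) (hG : ∀ a, G (-a) = G a) :
    tiltCov ((volume.restrict (smallField H s)).withDensity fun a => ENNReal.ofReal (gaussWeight β H a)) U 0 F G = 0 := by
  unfold tiltCov
  rw [tiltExp_muD_zero_mul_eq_zero_of_odd_even H hβ s U hF hG, tiltExp_muD_zero_eq_zero_of_odd H hβ s U hF, zero_mul, sub_zero]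

/-- ★ (e,e,o) with centring: `E_0[(F − m)(G − m′)·K] = 0` for `F`, `G` even and `K` odd — e.g. `F, G` the even parts of the plaquette costs and `K = −V₃`
the odd part of the tilt exponent. -/
theorem tiltExp_muD_zero_even_even_odd {β : ℝ} (hβ : 0 < β) (s : ℝ) (U : (LandauFree H → E3) → ℝ) {F G K : (LandauFree H → E3) → ℝ}
    (hF : ∀ a, F (-a) = F a) (hG : ∀ a, G (-a) = G a) (hK : ∀ a, K (-a) = -K a) (m m' : ℝ) :
    tiltExp ((volume.restrict (smallField H s)).withDensity fun a => ENNReal.ofReal (gaussWeight β H a)) U 0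
      (fun a => (F a - m) * (G a - m') * K a) = 0 :=
  tiltExp_muD_zero_eq_zero_of_odd H hβ s U fun a => by rw [hF, hG, hK, mul_neg]

/-- (o,o,o): `E_0[F·G·(K − k)]`'s odd piece — `E_0[F·G·K] = 0` for three odd factors. -/
theorem tiltExp_muD_zero_odd_odd_odd {β : ℝ} (hβ : 0 < β) (s : ℝ) (U : (LandauFree H → E3) → ℝ) {F G K : (LandauFree H → E3) → ℝ}
    (hF : ∀ a, F (-a) = -F a) (hG : ∀ a, G (-a) = -G a) (hK : ∀ a, K (-a) = -K a) :
    tiltExp ((volume.restrict (smallField H s)).withDensity fun a => ENNReal.ofReal (gaussWeight β H a)) U 0 (fun a => F a * G a * K a) = 0 :=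
  tiltExp_muD_zero_eq_zero_of_odd H hβ s U fun a => by rw [hF, hG, hK]; ring

/-- (e,o,e) with centring: `E_0[(F − m)·G·(K − k)] = 0` for `F`, `K` even and `G` odd. -/
theorem tiltExp_muD_zero_even_odd_even {β : ℝ} (hβ : 0 < β) (s : ℝ) (U : (LandauFree H → E3) → ℝ) {F G K : (LandauFree H → E3) → ℝ}
    (hF : ∀ a, F (-a) = F a) (hG : ∀ a, G (-a) = -G a) (hK : ∀ a, K (-a) = K a) (m k : ℝ) :
    tiltExp ((volume.restrict (smallField H s)).withDensity fun a => ENNReal.ofReal (gaussWeight β H a)) U 0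
      (fun a => (F a - m) * G a * (K a - k)) = 0 :=
  tiltExp_muD_zero_eq_zero_of_odd H hβ s U fun a => by rw [hF, hG, hK]; ring

/-- (o,e,e) with centring: `E_0[F·(G − m)·(K − k)] = 0` for `F` odd and `G`, `K` even. -/
theorem tiltExp_muD_zero_odd_even_even {β : ℝ} (hβ : 0 < β) (s : ℝ) (U : (LandauFree H → E3) → ℝ) {F G K : (LandauFree H → E3) → ℝ}
    (hF : ∀ a, F (-a) = -F a) (hG : ∀ a, G (-a) = G a) (hK : ∀ a, K (-a) = K a) (m k : ℝ) :
    tiltExp ((volume.restrict (smallField H s)).withDensity fun a => ENNReal.ofReal (gaussWeight β H a)) U 0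
      (fun a => F a * (G a - m) * (K a - k)) = 0 :=
  tiltExp_muD_zero_eq_zero_of_odd H hβ s U fun a => by rw [hF, hG, hK]; ring

/-- The named instance of §5: `E_0[V₃] = 0` on `μ_D` (the cubic vertex is odd, ✓`cubicVertex_neg`). -/
theorem tiltExp_muD_zero_cubicVertex {β : ℝ} (hβ : 0 < β) (s : ℝ) (U : (LandauFree H → E3) → ℝ) :
    tiltExp ((volume.restrict (smallField H s)).withDensity fun a => ENNReal.ofReal (gaussWeight β H a)) U 0 (cubicVertex β H) = 0 :=
  tiltExp_muD_zero_eq_zero_of_odd H hβ s U (EdgeChartGaussian.cubicVertex_neg β)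

end Tilt

end Summit.QuantumFields.YangMills.Theorems.AllWindowsColdBoxBoxHighLine

end
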